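import Literature.AlgebraicGeometry.Motives.WeilDiscriminant
import Literature.AlgebraicGeometry.Motives.WeilDiscriminantProduct
import HarnessLib

/-!
# Ring 2 · route `motiv` (generation 11) — the POLARISATION-CHANGE LAW for discriminant classes of sesquilinear forms, and its Weil-form instance

HONEST FRAMING: research route conditional on HC_CM; not a corollary; Q11.4-sentence-2 already refuted in dim ≥ 3.

Cell `pub-hodge-ring2`, seat `pub-hodge-ring2-motiv-g11`. Pure linear algebra over the tree's discriminant
infrastructure (`Literature.AlgebraicGeometry.Motives.gramMatrix` / `discrClass` / `weilHermitianForm` /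
`weilDiscriminant`, van Geemen 1994 Lemma 5.2). NO abelian varieties, NO named Literature fact, NO `HC_CM`
(KIND of `HC_CM` = ABSENT): this file is the kernel half of the seat's "transfer discriminant lemma"
(markdown `HOME/pub-hodge-ring2-motiv-g11/compute/MOTIV-G11-TRANSFER.md`, §M11.0 (c)), namely

* §1 `gramMatrix_compRight` / `det_gramMatrix_compRight`: composing a form `B(x, y)` that is `K`-linear in `y`
  with a `K`-linear map `u` on the right multiplies the Gram matrix by `[u]` on the right and the Gram
  determinant by `det u`;
* `discrClass_compRight_eq_mul`: hence the discriminant class in `Fˣ ⧸ Nm(Kˣ)` is multiplied by the class of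
  `det u` when `det u ∈ Fˣ` — the law "`δ(λ ∘ u) = δ(λ) · [det_K u]`";
* `discrClass_compRight_of_det_eq_norm` / `_of_det_eq_pow_finrank`: and it is UNCHANGED when `det u` is a norm
  from `K`, in particular when `det u = c ^ [K : F]`, `c ∈ Fˣ` — the RIGIDITY half (for `[K : F] = 2`: whenever
  `det_K u` is a rational square, e.g. `u` = multiplication by a totally real element on a space of EVEN rank over
  a CM field containing `K`);
* §2 the same three statements for van Geemen's Hermitian form `H = weilHermitianForm E α` of a `ℚ`-bilinear
  form `E` and its discriminant `weilDiscriminant E α ∈ ℚˣ ⧸ Nm(Kˣ)`: replacing the polarization form `E` by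
  `E(x, u y)` (`E.compl₂ u`, `u` `K`-linear) replaces `H` by `H(x, u y)` (`weilHermitianForm_compl₂`, no
  hypothesis), so `weilDiscriminant (E.compl₂ u) α = [det_K u] · weilDiscriminant E α` under the side condition
  that `H` is `K`-linear in `y` (hypothesis `hlin`) and `det Ψ ∈ ℚˣ`;
* §3 the same with the side conditions DISCHARGED under van Geemen's standing hypotheses (`K = ℚ + ℚα`,
  `α² = -d < 0`, `E` alternating, non-degenerate, `E(αx, αy) = d E(x, y)`) from the tree's `weilSesqForm`
  (5.2 (2)) and `exists_units_algebraMap_eq_det_gramMatrix` (5.2 (3)): `weilDiscriminant_compl₂_eq_mul_of_weil`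
  (the law), `…_of_det_eq_norm_of_weil`, `…_of_det_eq_sq_of_weil` (rigidity).

What this does NOT contain (and the seat does not claim in the kernel): the identification `det_K u = N_{E₀/ℚ}(f)^r`
for `u` = multiplication by `f ∈ E₀` on an `E`-vector space of rank `r` (`E = E₀K` a CM field) and the TRANSFER
identity `det Tr_{E/K} ∘ H_E = d(x)^r · N_{E₀/ℚ}(det H_E)` (MOTIV-G11 §M11.0 (a)) — both DERIVED in the markdown with
an exact-arithmetic certificate (`transfer_disc_g11.py`, 1407 instances), not formalised here; nor any statement
about abelian varieties (the cell consequences M11.1 / M11.2 — every member of the quartic-CM `(3,3)` sixfold cell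
admits a hyperbolic polarisation; the sextic-CM cell's discriminant is polarisation-rigid — stay DERIVED prose).
-/

set_option linter.dupNamespace false

namespace Summit.HodgeConjecture.HodgeConjecture.Ring2.Motiv

open Module
open scoped Matrix
open Literature.AlgebraicGeometry.Motives

universe u

/-! ### §1 Right composition with a linear map: Gram matrix, determinant, discriminant class -/

section CompRight

variable {K V ι : Type*} [Field K] [AddCommGroup V] [Module K V] [Fintype ι] [DecidableEq ι]

/-- **Gram matrix of `B(x, u y)`**: if `B` is additive and `K`-homogeneous in the second variable and `u` is
`K`-linear, then in any basis `b` the Gram matrix of `(x, y) ↦ B(x, u y)` is `Gram_b(B) · [u]_b`. [folklore] -/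
theorem gramMatrix_compRight (B : V → V → K)
    (hadd : ∀ x y z, B x (y + z) = B x y + B x z) (hsmul : ∀ (x : V) (c : K) (y : V), B x (c • y) = c * B x y)
    (u : V →ₗ[K] V) (b : Basis ι K V) :
    gramMatrix (fun x y => B x (u y)) b = gramMatrix B b * LinearMap.toMatrix b b u := by
  ext i j
  have hu : u (b j) = ∑ l, LinearMap.toMatrix b b u l j • b l := by
    simp_rw [LinearMap.toMatrix_apply]
    rw [b.sum_repr]
  let φ : V →ₗ[K] K :=
    { toFun := fun y => B (b i) y
      map_add' := fun y z => hadd _ _ _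
      map_smul' := fun c y => by rw [hsmul, smul_eq_mul, RingHom.id_apply] }
  have hφ : ∀ y, φ y = B (b i) y := fun _ => rfl
  simp only [gramMatrix_apply, Matrix.mul_apply]
  rw [hu, ← hφ, map_sum]
  refine Finset.sum_congr rfl fun l _ => ?_
  rw [map_smul, smul_eq_mul, hφ, mul_comm]

/-- **`det Gram(B(·, u ·)) = det Gram(B) · det u`.** [folklore] -/
theorem det_gramMatrix_compRight (B : V → V → K)
    (hadd : ∀ x y z, B x (y + z) = B x y + B x z) (hsmul : ∀ (x : V) (c : K) (y : V), B x (c • y) = c * B x y)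
    (u : V →ₗ[K] V) (b : Basis ι K V) :
    (gramMatrix (fun x y => B x (u y)) b).det = (gramMatrix B b).det * LinearMap.det u := by
  rw [gramMatrix_compRight B hadd hsmul u b, Matrix.det_mul, LinearMap.det_toMatrix]

variable (F : Type*) [Field F] [Algebra F K]

/-- **Polarisation-change law for the discriminant class** ("`δ(λ ∘ u) = [det u] · δ(λ)`"): if the Gram
determinant of `B` lies in `Fˣ` and `det u = c ∈ Fˣ`, then the discriminant class of `B(x, u y)` in
`Fˣ ⧸ Nm(Kˣ)` is `c · discrClass B`. [folklore] -/
theorem discrClass_compRight_eq_mul [Module.Finite K V] (B : V → V → K)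
    (hadd : ∀ x y z, B x (y + z) = B x y + B x z) (hsmul : ∀ (x : V) (c : K) (y : V), B x (c • y) = c * B x y)
    (u : V →ₗ[K] V) (c : Fˣ) (hu : LinearMap.det u = algebraMap F K c)
    (hB : ∃ d : Fˣ, algebraMap F K d = (gramMatrix B ⇑(Module.finBasis K V)).det) :
    discrClass F (fun x y => B x (u y)) =
      (QuotientGroup.mk c : Fˣ ⧸ normUnitsSubgroup F K) * discrClass F B := by
  obtain ⟨d, hd⟩ := hB
  rw [discrClass_def, discrClass_def, det_gramMatrix_compRight B hadd hsmul u, hu, ← hd, ← map_mul,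
    ← Units.val_mul, normResidueClass_algebraMap, normResidueClass_algebraMap, mul_comm d c,
    QuotientGroup.mk_mul]

/-- **Rigidity under norm determinants**: if `det u = Nm_{K/F}(k)` for a unit `k` of `K`, the discriminant
class of `B(x, u y)` equals that of `B` (no hypothesis on `Gram(B)`: both junk values agree). [folklore] -/
theorem discrClass_compRight_of_det_eq_norm [Module.Finite K V] (B : V → V → K)
    (hadd : ∀ x y z, B x (y + z) = B x y + B x z) (hsmul : ∀ (x : V) (c : K) (y : V), B x (c • y) = c * B x y)
    (u : V →ₗ[K] V) (k : Kˣ) (hu : LinearMap.det u = algebraMap F K (Algebra.norm F (k : K))) :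
    discrClass F (fun x y => B x (u y)) = discrClass F B := by
  rw [discrClass_def, discrClass_def, det_gramMatrix_compRight B hadd hsmul u, hu, mul_comm]
  exact normResidueClass_norm_mul F k _

/-- **Rigidity under `[K : F]`-th-power determinants**: if `det u = c ^ [K : F]` with `c ∈ Fˣ` (for a quadratic
extension: `det u` is a square of `F`), the discriminant class of `B(x, u y)` equals that of `B` — the
mechanism behind "the Weil discriminant of a cell of EVEN rank over its CM field does not depend on the
polarisation" (MOTIV-G11 §M11.2). [folklore] -/
theorem discrClass_compRight_of_det_eq_pow_finrank [Module.Finite K V] (B : V → V → K)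
    (hadd : ∀ x y z, B x (y + z) = B x y + B x z) (hsmul : ∀ (x : V) (c : K) (y : V), B x (c • y) = c * B x y)
    (u : V →ₗ[K] V) (c : Fˣ) (hu : LinearMap.det u = algebraMap F K ((c : F) ^ Module.finrank F K)) :
    discrClass F (fun x y => B x (u y)) = discrClass F B := by
  refine discrClass_compRight_of_det_eq_norm F B hadd hsmul u
    (Units.map (algebraMap F K : F →* K) c) ?_
  rw [hu, Units.coe_map, MonoidHom.coe_coe, Algebra.norm_algebraMap]

end CompRight

/-! ### §2 The instance for van Geemen's Hermitian form and the Weil discriminant -/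

section Weil

variable {K : Type*} [Field K] [Algebra ℚ K] {V : Type u} [AddCommGroup V] [Module ℚ V] [Module K V]
  [IsScalarTower ℚ K V]

/-- **Changing the polarization form by a `K`-linear map on the right changes `H` the same way**:
`H_{E(·, u ·)}(x, y) = H_E(x, u y)` for `u` `K`-linear (it commutes with `α`). [folklore] -/
theorem weilHermitianForm_compl₂ (E : LinearMap.BilinForm ℚ V) (α : K) (u : V →ₗ[K] V) (x y : V) :
    weilHermitianForm (E.compl₂ (u.restrictScalars ℚ)) α x y = weilHermitianForm E α x (u y) := by
  simp only [weilHermitianForm_apply, LinearMap.compl₂_apply, LinearMap.restrictScalars_apply, map_smul]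

/-- The Weil discriminant of the modified polarization form is the discriminant class of `H_E(x, u y)`. [folklore] -/
theorem weilDiscriminant_compl₂ [Module.Finite K V] (E : LinearMap.BilinForm ℚ V) (α : K) (u : V →ₗ[K] V) :
    weilDiscriminant (E.compl₂ (u.restrictScalars ℚ)) α =
      discrClass ℚ (fun x y => weilHermitianForm E α x (u y)) := by
  unfold weilDiscriminant
  congr 1
  funext x y
  exact weilHermitianForm_compl₂ E α u x y

/-- **Polarisation-change law for the Weil discriminant** ("`det H` changes by `det_K u`"): if `H_E` is
`K`-linear in the second variable (van Geemen 5.2 (2)), its Gram determinant is rational, and `det_K u = c ∈ ℚˣ`,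
then `weilDiscriminant (E(·, u ·)) α = c · weilDiscriminant E α` in `ℚˣ ⧸ Nm(Kˣ)`. [folklore] -/
theorem weilDiscriminant_compl₂_eq_mul [Module.Finite K V] (E : LinearMap.BilinForm ℚ V) (α : K)
    (hlin : ∀ (x : V) (c : K) (y : V), weilHermitianForm E α x (c • y) = c * weilHermitianForm E α x y)
    (u : V →ₗ[K] V) (c : ℚˣ) (hu : LinearMap.det u = algebraMap ℚ K c)
    (hE : ∃ d : ℚˣ, algebraMap ℚ K d =
      (gramMatrix (weilHermitianForm E α) ⇑(Module.finBasis K V)).det) :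
    weilDiscriminant (E.compl₂ (u.restrictScalars ℚ)) α =
      (QuotientGroup.mk c : ℚˣ ⧸ normUnitsSubgroup ℚ K) * weilDiscriminant E α := by
  rw [weilDiscriminant_compl₂, weilDiscriminant]
  exact discrClass_compRight_eq_mul ℚ (weilHermitianForm E α) (weilHermitianForm_add_right E α) hlin u c hu hE

/-- **Rigidity of the Weil discriminant under norm-determinant changes of polarization**: if `H_E` is `K`-linear
in `y` and `det_K u = Nm_{K/ℚ}(k)`, then `weilDiscriminant (E(·, u ·)) α = weilDiscriminant E α`. [folklore] -/
theorem weilDiscriminant_compl₂_of_det_eq_norm [Module.Finite K V] (E : LinearMap.BilinForm ℚ V) (α : K)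
    (hlin : ∀ (x : V) (c : K) (y : V), weilHermitianForm E α x (c • y) = c * weilHermitianForm E α x y)
    (u : V →ₗ[K] V) (k : Kˣ) (hu : LinearMap.det u = algebraMap ℚ K (Algebra.norm ℚ (k : K))) :
    weilDiscriminant (E.compl₂ (u.restrictScalars ℚ)) α = weilDiscriminant E α := by
  rw [weilDiscriminant_compl₂, weilDiscriminant]
  exact discrClass_compRight_of_det_eq_norm ℚ (weilHermitianForm E α) (weilHermitianForm_add_right E α) hlin u k hu

/-- **Rigidity under square determinants** (`K/ℚ` quadratic): if `H_E` is `K`-linear in `y`, `[K : ℚ] = 2` and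
`det_K u = c²` with `c ∈ ℚˣ`, the Weil discriminant is unchanged — e.g. `u` = multiplication by a totally
positive element of the real subfield of a CM field `E ⊃ K` acting on `V` of EVEN `E`-rank (MOTIV-G11 §M11.2:
the sextic-CM sixfold cell). [folklore] -/
theorem weilDiscriminant_compl₂_of_det_eq_sq [Module.Finite K V] (hK : Module.finrank ℚ K = 2)
    (E : LinearMap.BilinForm ℚ V) (α : K)
    (hlin : ∀ (x : V) (c : K) (y : V), weilHermitianForm E α x (c • y) = c * weilHermitianForm E α x y)
    (u : V →ₗ[K] V) (c : ℚˣ) (hu : LinearMap.det u = algebraMap ℚ K ((c : ℚ) ^ 2)) :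
    weilDiscriminant (E.compl₂ (u.restrictScalars ℚ)) α = weilDiscriminant E α := by
  rw [weilDiscriminant_compl₂, weilDiscriminant]
  refine discrClass_compRight_of_det_eq_pow_finrank ℚ (weilHermitianForm E α) (weilHermitianForm_add_right E α)
    hlin u c ?_
  rw [hu, hK]

/-! ### §3 The law under van Geemen's standing hypotheses (`K = ℚ(α)`, `α² = -d < 0`, `E` a Riemann form of Weil type)

Here the side conditions of §2 are DISCHARGED from the tree: `H` is `K`-linear in `y`
(`Literature.AlgebraicGeometry.Motives.weilSesqForm`, van Geemen 5.2 (2)) and `det Ψ ∈ ℚˣ`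
(`exists_units_algebraMap_eq_det_gramMatrix`, van Geemen 5.2 (3)). -/

/-- `H(x, c y) = c H(x, y)` for all `c ∈ K = ℚ + ℚα` (from the bundled `weilSesqForm`). [cite: vanGeemen1994HodgeAV, Lemma 5.2 (2)] -/
theorem weilHermitianForm_smul_right_of_weil (E : LinearMap.BilinForm ℚ V) {α : K} {d : ℚ} (σ : K →+* K)
    (hd : d ≠ 0) (hα : α * α = algebraMap ℚ K (-d)) (hW : ∀ x y : V, E (α • x) (α • y) = d * E x y)
    (hσα : σ α = -α) (hK : ∀ k : K, ∃ a b : ℚ, k = algebraMap ℚ K a + algebraMap ℚ K b * α)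
    (x : V) (c : K) (y : V) :
    weilHermitianForm E α x (c • y) = c * weilHermitianForm E α x y := by
  rw [← weilSesqForm_apply E σ hd hα hW hσα hK, ← weilSesqForm_apply E σ hd hα hW hσα hK, map_smul,
    smul_eq_mul]

/-- **Polarisation-change law for Weil-type data** (MOTIV-G11 §M11.0 (c), kernel form): for `(V, K = ℚ(α), E)` with
`α² = -d < 0`, `E` alternating, non-degenerate, `E(αx, αy) = d E(x, y)`, and a `K`-linear `u` with
`det_K u = c ∈ ℚˣ`: `disc(E(·, u ·)) = c · disc(E)` in `ℚˣ ⧸ Nm(Kˣ)`. (For `u` = a Rosati-symmetric totally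
positive endomorphism this is the change of polarization `λ ↦ λ ∘ u`.) [folklore] -/
theorem weilDiscriminant_compl₂_eq_mul_of_weil [Module.Finite K V] (E : LinearMap.BilinForm ℚ V) {α : K}
    {d : ℚ} (σ : K →+* K) (hd : 0 < d) (hα : α * α = algebraMap ℚ K (-d)) (hE : ∀ x y : V, E y x = -E x y)
    (hW : ∀ x y : V, E (α • x) (α • y) = d * E x y) (hN : E.Nondegenerate) (hσα : σ α = -α)
    (hK : ∀ k : K, ∃ a b : ℚ, k = algebraMap ℚ K a + algebraMap ℚ K b * α)
    (u : V →ₗ[K] V) (c : ℚˣ) (hu : LinearMap.det u = algebraMap ℚ K c) :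
    weilDiscriminant (E.compl₂ (u.restrictScalars ℚ)) α =
      (QuotientGroup.mk c : ℚˣ ⧸ normUnitsSubgroup ℚ K) * weilDiscriminant E α :=
  weilDiscriminant_compl₂_eq_mul E α (weilHermitianForm_smul_right_of_weil E σ hd.ne' hα hW hσα hK) u c hu
    (exists_units_algebraMap_eq_det_gramMatrix E σ hd hα hE hW hN hσα hK (Module.finBasis K V))

/-- **Rigidity for Weil-type data, norm determinants**: `det_K u = Nm_{K/ℚ}(k)` ⇒ the discriminant is unchanged. [folklore] -/
theorem weilDiscriminant_compl₂_of_det_eq_norm_of_weil [Module.Finite K V] (E : LinearMap.BilinForm ℚ V)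
    {α : K} {d : ℚ} (σ : K →+* K) (hd : d ≠ 0) (hα : α * α = algebraMap ℚ K (-d))
    (hW : ∀ x y : V, E (α • x) (α • y) = d * E x y) (hσα : σ α = -α)
    (hK : ∀ k : K, ∃ a b : ℚ, k = algebraMap ℚ K a + algebraMap ℚ K b * α)
    (u : V →ₗ[K] V) (k : Kˣ) (hu : LinearMap.det u = algebraMap ℚ K (Algebra.norm ℚ (k : K))) :
    weilDiscriminant (E.compl₂ (u.restrictScalars ℚ)) α = weilDiscriminant E α :=
  weilDiscriminant_compl₂_of_det_eq_norm E α (weilHermitianForm_smul_right_of_weil E σ hd hα hW hσα hK) u k hu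

/-- **Rigidity for Weil-type data, square determinants** (`[K : ℚ] = 2`): `det_K u = c²`, `c ∈ ℚˣ` ⇒ the
discriminant is unchanged (MOTIV-G11 §M11.2: EVEN rank over the CM field ⇒ polarisation-rigid discriminant). [folklore] -/
theorem weilDiscriminant_compl₂_of_det_eq_sq_of_weil [Module.Finite K V] (hK2 : Module.finrank ℚ K = 2)
    (E : LinearMap.BilinForm ℚ V) {α : K} {d : ℚ} (σ : K →+* K) (hd : d ≠ 0)
    (hα : α * α = algebraMap ℚ K (-d)) (hW : ∀ x y : V, E (α • x) (α • y) = d * E x y) (hσα : σ α = -α)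
    (hK : ∀ k : K, ∃ a b : ℚ, k = algebraMap ℚ K a + algebraMap ℚ K b * α)
    (u : V →ₗ[K] V) (c : ℚˣ) (hu : LinearMap.det u = algebraMap ℚ K ((c : ℚ) ^ 2)) :
    weilDiscriminant (E.compl₂ (u.restrictScalars ℚ)) α = weilDiscriminant E α :=
  weilDiscriminant_compl₂_of_det_eq_sq hK2 E α (weilHermitianForm_smul_right_of_weil E σ hd hα hW hσα hK) u c hu

end Weil

end Summit.HodgeConjecture.HodgeConjecture.Ring2.Motiv
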